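import Literature.Algebra.EuclideanLattices.LLLMachineStep
import Literature.Algebra.EuclideanLattices.LLLRunBounds
import Literature.Computability.Complexity.PlumbingBricks
import Literature.Computability.Complexity.FoldBricks
import Literature.Computability.Complexity.RandomizedProofs
import HarnessLib

/-!
# The LLL machine, III: parsing, the main loop, the output, and `lllReduce_polyTime`

Trunk: Lattice; completes `LLLMachineTables.lean` / `LLLMachineStep.lean` (the saturated LLL pass
`capStepF` as a total `FP` string function) and `LLLRunBounds.lean` (on a nonsingular instance,
`lllBudget L` rounds of `capStep (lllBudget L)` compute `LatticeInstance.lllReduce`). Here: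

* `mainBody`, `lllCoreF ⟨x, ⟨bin n, matCode b⟩⟩ = matCode ((capStep |x|)^[|x|] (lllStart b)).b` — the
  clocked main loop (`|x|` rounds);
* the parser: `yardF inp = 1^{lllBudget |inp|}` (`Plumb.polyFn`), the flat entry list recoded to
  canonical integer codes (`ofSMFn`, `mapLF`), chunked into `n` rows (`chunkBody`), so that
  `parseF (encode I) = ⟨x, ⟨bin n, matCode I.basis⟩⟩`;
* the output: rows flattened (`flatBody`), entries recoded to sign–magnitude (`signMagOfZF`), headers
  copied from the input, so that `outF ⟨encode I, matCode b'⟩ = encode ⟨I.n, b'⟩`;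
* `lllMachineF ∈ FP` and **`lllMachineF_encode`**: on the code of every instance the machine returns the
  code of the saturated run; hence **`lllReduce_polyTime_holds`** (LLL82 Prop. 1.26: LLL's algorithm with
  `δ = 3/4` on integer bases is polynomial-time, in the tree's `TM2` model), by
  `PolyTimeComputable.of_encode_eq` and `LatticeInstance.lllReduce_eq_capRun`.

## References

* A. K. Lenstra, H. W. Lenstra Jr., L. Lovász, *Factoring polynomials with rational coefficients*,
  Math. Ann. 261 (1982), Prop. 1.26.
* S. Arora, B. Barak, *Computational Complexity: A Modern Approach*, CUP 2009, §1.3, §1.4.1.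
-/

noncomputable section

namespace Literature.Algebra.EuclideanLattices

open _root_.Computability Literature.Computability.Complexity Literature.Computability.Complexity.Brick Polynomial

namespace LLLMachine

variable {n : ℕ}

/-! ### The main loop -/

/-- The body of the main loop on `⟨x, ⟨cnt, ⟨nn, ⟨kk, M⟩⟩⟩⟩`: `⟨nn, capStepF ⟨x, ⟨nn, ⟨kk, M⟩⟩⟩⟩`.
[cite: LenstraLenstraLovasz1982, §1 Fig. 1] -/
def mainBody : List Bool → List Bool := fanoutFn (nthF 2) (capStepF ∘ fanoutFn (nthF 0) (sndPow 1))

/-- `mainBody ∈ FP`. [folklore] -/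
theorem mainBody_mem_FP : mainBody ∈ FP :=
  fanoutFn_mem_FP (nthF_mem_FP 2) (comp_mem_FP capStepF_mem_FP (fanoutFn_mem_FP (nthF_mem_FP 0) (sndPow_mem_FP 1)))

/-- Growth of the main body: `≤ |state| + stepGrowth(|x|) + 2`. [folklore] -/
theorem length_mainBody_le (z : List Bool) : (mainBody z).length ≤ (sndPow 1 z).length + (stepGrowth + 2).eval (fstF z).length := by
  have c1 := length_nthF_succ_add_sndPow_succ_le 1 z
  have h := length_capStepF_le (boolPair (nthF 0 z) (sndPow 1 z))
  simp only [sndPow_succ_boolPair, sndPow_zero, fstF_boolPair, sndF_sndPow, Nat.reduceAdd] at h c1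
  simp only [mainBody, fanoutFn_apply, length_boolPair, Function.comp_apply, eval_add, eval_ofNat, nthF_zero]
  have : nthF 0 z = fstF z := rfl
  rw [this] at h
  omega

/-- **Semantics of `mainBody`**: one saturated pass. [cite: LenstraLenstraLovasz1982, §1 Fig. 1] -/
theorem mainBody_apply (x c : List Bool) (s : LLLState n (Fin n → ℤ)) (hx : n + 1 ≤ x.length) :
    mainBody (boolPair x (boolPair c (boolPair (encodeNat n) (boolPair (encodeNat s.k) (matCode s.b))))) =
      boolPair (encodeNat n) (boolPair (encodeNat (capStep x.length s).k) (matCode (capStep x.length s).b)) := by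
  simp only [mainBody, fanoutFn_apply, nthF_succ_boolPair, nthF_zero_boolPair, Function.comp_apply, sndPow_succ_boolPair,
    sndPow_zero, sndF_boolPair]
  rw [capStepF_apply x s.b s.k hx]

/-- **The main loop runs the saturated passes.** [cite: LenstraLenstraLovasz1982, §1 Fig. 1] -/
theorem loopModel_mainBody (x : List Bool) (hx : n + 1 ≤ x.length) :
    ∀ (t : ℕ) (s : LLLState n (Fin n → ℤ)),
      loopModel mainBody x t (boolPair (encodeNat n) (boolPair (encodeNat s.k) (matCode s.b))) =
        boolPair (encodeNat n) (boolPair (encodeNat ((capStep x.length)^[t] s).k) (matCode ((capStep x.length)^[t] s).b))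
  | 0, s => rfl
  | t + 1, s => by
    rw [loopModel, mainBody_apply x _ s hx, loopModel_mainBody x hx t (capStep x.length s), Function.iterate_succ_apply]

/-- The initial record of the main loop from `⟨x, ⟨nn, M⟩⟩`: counter `bin |x|`, state `⟨nn, ⟨bin 1, M⟩⟩`. [folklore] -/
def mainInit : List Bool → List Bool :=
  fanoutFn (nthF 0) (fanoutFn (lenBinF ∘ nthF 0) (fanoutFn (nthF 1) (fanoutFn (fun _ => encodeNat 1) (sndPow 1))))

/-- `mainInit ∈ FP`. [folklore] -/
theorem mainInit_mem_FP : mainInit ∈ FP :=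
  fanoutFn_mem_FP (nthF_mem_FP 0) (fanoutFn_mem_FP (comp_mem_FP lenBinF_mem_FP (nthF_mem_FP 0)) (fanoutFn_mem_FP (nthF_mem_FP 1)
    (fanoutFn_mem_FP (const_mem_FP _) (sndPow_mem_FP 1))))

/-- **The core of the machine**: `lllCoreF ⟨x, ⟨nn, M⟩⟩` runs `|x|` saturated passes from index `1` and
returns the matrix. [cite: LenstraLenstraLovasz1982, §1 Fig. 1 and Prop. 1.26] -/
def lllCoreF : List Bool → List Bool := sndPow 3 ∘ loopX mainBody ∘ mainInit

/-- `lllCoreF ∈ FP`. [folklore] -/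
theorem lllCoreF_mem_FP : lllCoreF ∈ FP :=
  comp_mem_FP (sndPow_mem_FP 3) (comp_mem_FP (loopX_mem_FP mainBody_mem_FP length_mainBody_le) mainInit_mem_FP)

/-- **Semantics of `lllCoreF`**: the matrix after `|x|` rounds of `capStep |x|` from `lllStart b`
(`n + 1 ≤ |x|`). [cite: LenstraLenstraLovasz1982, Prop. 1.26] -/
theorem lllCoreF_apply (x : List Bool) (b : Fin n → (Fin n → ℤ)) (hx : n + 1 ≤ x.length) :
    lllCoreF (boolPair x (boolPair (encodeNat n) (matCode b))) = matCode ((capStep x.length)^[x.length] (lllStart b)).b := by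
  have e : mainInit (boolPair x (boolPair (encodeNat n) (matCode b))) =
      boolPair x (boolPair (encodeNat x.length) (boolPair (encodeNat n) (boolPair (encodeNat 1) (matCode b)))) := by
    simp [mainInit]
  rw [lllCoreF, Function.comp_apply, Function.comp_apply, e, loopX_apply _ _ _ le_rfl,
    show boolPair (encodeNat n) (boolPair (encodeNat 1) (matCode b)) =
      boolPair (encodeNat n) (boolPair (encodeNat (lllStart b).k) (matCode (lllStart b).b)) from rfl,
    loopModel_mainBody x hx]
  simp

/-! ### Parsing the input -/

/-- The budget polynomial `64 (X + 1)³` (`lllBudget`). [folklore] -/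
def budgetPoly : Polynomial ℕ := 64 * (X + 1) ^ 3

/-- Evaluation of `budgetPoly`. [folklore] -/
@[simp] theorem budgetPoly_eval (L : ℕ) : budgetPoly.eval L = lllBudget L := by simp [budgetPoly, lllBudget]

/-- **The yardstick of an input**: `1^{lllBudget |inp|}`. [folklore] -/
def yardF : List Bool → List Bool := Plumb.polyFn budgetPoly

/-- `|yardF inp| = lllBudget |inp|`. [folklore] -/
@[simp] theorem length_yardF (inp : List Bool) : (yardF inp).length = lllBudget inp.length := by
  simp [yardF]

/-- `yardF ∈ FP`. [folklore] -/
theorem yardF_mem_FP : yardF ∈ FP := Plumb.polyFn_mem_FP _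

/-- The entry recoder on the item record `⟨x, ⟨p, e⟩⟩`: `ofSMFn e`. [folklore] -/
def zItem : List Bool → List Bool := ofSMFn ∘ sndPow 1

/-- `zItem ∈ FP`. [folklore] -/
theorem zItem_mem_FP : zItem ∈ FP := comp_mem_FP ofSMFn_mem_FP (sndPow_mem_FP 1)

/-- `|zItem ⟨x, ⟨p, e⟩⟩| ≤ 2|e| + 2`. [folklore] -/
theorem length_zItem_le (x p e : List Bool) : (zItem (boolPair x (boolPair p e))).length ≤ 2 * e.length + (2 : Polynomial ℕ).eval x.length := by
  simpa [zItem] using length_ofSMFn_le e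

/-- **The flat list of canonical entry codes** of an input `inp = ⟨nn, ⟨hdr, E⟩⟩`: the map of `ofSMFn` over the
`n²` items of `E`, on `⟨x, ⟨bin n², ⟨ε, E⟩⟩⟩`. [folklore] -/
def entriesF : List Bool → List Bool :=
  mapLF zItem ∘ fanoutFn yardF (fanoutFn (prodFn ∘ fanoutFn fstF fstF) (fanoutFn (fun _ => []) (sndF ∘ sndF)))

/-- `entriesF ∈ FP`. [folklore] -/
theorem entriesF_mem_FP : entriesF ∈ FP :=
  comp_mem_FP (mapLF_mem_FP zItem_mem_FP (w := 2) le_rfl length_zItem_le)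
    (fanoutFn_mem_FP yardF_mem_FP (fanoutFn_mem_FP (comp_mem_FP prodFn_mem_FP (fanoutFn_mem_FP fstF_mem_FP fstF_mem_FP))
      (fanoutFn_mem_FP (const_mem_FP _) (comp_mem_FP sndF_mem_FP sndF_mem_FP))))

/-- `takeLF`: the first `⟦cnt⟧` items in order (two reversals). [folklore] -/
def takeLF : List Bool → List Bool := takeRevLF ∘ fanoutFn (nthF 0) (fanoutFn (nthF 1) takeRevLF)

/-- `takeLF ∈ FP`. [folklore] -/
theorem takeLF_mem_FP : takeLF ∈ FP :=
  comp_mem_FP takeRevLF_mem_FP (fanoutFn_mem_FP (nthF_mem_FP 0) (fanoutFn_mem_FP (nthF_mem_FP 1) takeRevLF_mem_FP))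

/-- Semantics of `takeLF`. [folklore] -/
theorem takeLF_apply (x : List Bool) {k : ℕ} (hk : k ≤ x.length) (L : List (List Bool)) :
    takeLF (boolPair x (boolPair (encodeNat k) (encList L))) = encList (L.take k) := by
  simp only [takeLF, Function.comp_apply, fanoutFn_apply, nthF_zero_boolPair, nthF_succ_boolPair]
  rw [takeRevLF_apply x hk, takeRevLF_apply x hk, List.take_of_length_le (by simp), List.reverse_reverse]

/-- `|takeLF z| ≤ |sndPow 1 z| + 4|x|`, and jointly with `dropLF`: `|takeLF z| + |dropLF z| ≤ |l| + 6|x|`. [folklore] -/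
theorem length_takeLF_add_dropLF_le (z : List Bool) :
    (takeLF z).length + (dropLF z).length ≤ (sndPow 1 z).length + 6 * (fstF z).length := by
  have h1 := length_takeRevLF_le (boolPair (nthF 0 z) (boolPair (nthF 1 z) (takeRevLF z)))
  have h2 := length_takeRevLF_add_dropLF_le z
  simp only [fstF_boolPair, sndPow_succ_boolPair, sndPow_zero, sndF_boolPair] at h1
  rw [takeLF, Function.comp_apply, fanoutFn_apply, fanoutFn_apply]
  have : nthF 0 z = fstF z := rfl
  rw [this] at h1 ⊢
  omega

/-- The body of the chunking loop on `⟨x, ⟨cnt, ⟨nn, ⟨rest, acc⟩⟩⟩⟩`: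
`⟨nn, ⟨drop n rest, ⟨take n rest, acc⟩⟩⟩`. [folklore] -/
def chunkBody : List Bool → List Bool :=
  fanoutFn (nthF 2) (fanoutFn (dropLF ∘ fanoutFn (nthF 0) (fanoutFn (nthF 2) (nthF 3)))
    (fanoutFn (takeLF ∘ fanoutFn (nthF 0) (fanoutFn (nthF 2) (nthF 3))) (sndPow 3)))

/-- `chunkBody ∈ FP`. [folklore] -/
theorem chunkBody_mem_FP : chunkBody ∈ FP :=
  fanoutFn_mem_FP (nthF_mem_FP 2) (fanoutFn_mem_FP (comp_mem_FP dropLF_mem_FP (fanoutFn_mem_FP (nthF_mem_FP 0) (fanoutFn_mem_FP (nthF_mem_FP 2) (nthF_mem_FP 3))))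
    (fanoutFn_mem_FP (comp_mem_FP takeLF_mem_FP (fanoutFn_mem_FP (nthF_mem_FP 0) (fanoutFn_mem_FP (nthF_mem_FP 2) (nthF_mem_FP 3)))) (sndPow_mem_FP 3)))

/-- Growth of the chunking body: `≤ |state| + 12|x| + 6`. [folklore] -/
theorem length_chunkBody_le (z : List Bool) : (chunkBody z).length ≤ (sndPow 1 z).length + (12 * X + 6 : Polynomial ℕ).eval (fstF z).length := by
  have c1 := length_nthF_succ_add_sndPow_succ_le 1 z
  have c2 := length_nthF_succ_add_sndPow_succ_le 2 z
  have h := length_takeLF_add_dropLF_le (boolPair (nthF 0 z) (boolPair (nthF 2 z) (nthF 3 z)))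
  simp only [fstF_boolPair, sndPow_succ_boolPair, sndPow_zero, sndF_boolPair, Nat.reduceAdd] at h c1 c2
  simp only [chunkBody, fanoutFn_apply, length_boolPair, Function.comp_apply, eval_add, eval_mul, eval_ofNat, eval_X]
  have : nthF 0 z = fstF z := rfl
  simp only [this] at h ⊢
  omega

/-- **One round of chunking** a flat list of `zlist` rows. [folklore] -/
theorem chunkBody_apply (x c : List Bool) (hx : n ≤ x.length) (L : List (List Bool)) (A : List (List Bool)) :
    chunkBody (boolPair x (boolPair c (boolPair (encodeNat n) (boolPair (encList L) (encList A))))) =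
      boolPair (encodeNat n) (boolPair (encList (L.drop n)) (boolPair (encList (L.take n)) (encList A))) := by
  simp only [chunkBody, fanoutFn_apply, nthF_succ_boolPair, nthF_zero_boolPair, Function.comp_apply, sndPow_succ_boolPair, sndPow_zero,
    sndF_boolPair]
  rw [dropLF_apply x hx, takeLF_apply x hx]

/-- The chunking loop: after `t` rounds the rows of a flattened list of rows are peeled off. [folklore] -/
theorem loopModel_chunkBody (x : List Bool) (hx : n ≤ x.length) :
    ∀ (t : ℕ) (R : List (List (List Bool))) (A : List (List Bool)), (∀ r ∈ R, r.length = n) → t ≤ R.length →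
      loopModel chunkBody x t (boolPair (encodeNat n) (boolPair (encList R.flatten) (encList A))) =
        boolPair (encodeNat n) (boolPair (encList (R.drop t).flatten) (encList (((R.take t).map encList).reverse ++ A)))
  | 0, R, A, _, _ => by simp [loopModel]
  | t + 1, [], A, _, h => by simp at h
  | t + 1, r :: R, A, hR, h => by
    have hr : r.length = n := hR r (by simp)
    rw [loopModel, List.flatten_cons, chunkBody_apply x _ hx, List.drop_append_of_le_length hr.ge, List.take_append_of_le_length hr.ge,
      List.drop_of_length_le hr.le, List.nil_append, List.take_of_length_le hr.le, ← encList_cons,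
      loopModel_chunkBody x hx t R (encList r :: A) (fun r' hr' => hR r' (by simp [hr'])) (by simpa using h)]
    simp

/-- The initial record of the chunking loop from `inp`: `⟨x, ⟨nn, ⟨nn, ⟨entriesF inp, ε⟩⟩⟩⟩`. [folklore] -/
def chunkInit : List Bool → List Bool :=
  fanoutFn yardF (fanoutFn fstF (fanoutFn fstF (fanoutFn entriesF (fun _ => []))))

/-- `chunkInit ∈ FP`. [folklore] -/
theorem chunkInit_mem_FP : chunkInit ∈ FP :=
  fanoutFn_mem_FP yardF_mem_FP (fanoutFn_mem_FP fstF_mem_FP (fanoutFn_mem_FP fstF_mem_FP (fanoutFn_mem_FP entriesF_mem_FP (const_mem_FP _))))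

/-- **The parser**: `parseF inp = ⟨x, ⟨nn, M₀⟩⟩` with `M₀` the rows of the recoded entries, in order. [folklore] -/
def parseF : List Bool → List Bool :=
  fanoutFn yardF (fanoutFn fstF (takeRevLF ∘ fanoutFn (nthF 0) (fanoutFn (nthF 2) (sndPow 3)) ∘ loopX chunkBody ∘ chunkInit))

/-- `parseF ∈ FP`. [folklore] -/
theorem parseF_mem_FP : parseF ∈ FP :=
  fanoutFn_mem_FP yardF_mem_FP (fanoutFn_mem_FP fstF_mem_FP
    (comp_mem_FP takeRevLF_mem_FP (comp_mem_FP (fanoutFn_mem_FP (nthF_mem_FP 0) (fanoutFn_mem_FP (nthF_mem_FP 2) (sndPow_mem_FP 3)))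
      (comp_mem_FP (loopX_mem_FP chunkBody_mem_FP length_chunkBody_le) chunkInit_mem_FP))))

/-! #### The parser on the code of an instance -/

/-- The row-major entry function of an instance (as in `encodingIntMatrixFin`). [folklore] -/
def flatEntries (b : Fin n → (Fin n → ℤ)) : Fin (n * n) → ℤ := fun m => b (finProdFinEquiv.symm m).1 (finProdFinEquiv.symm m).2

/-- `foldr boolPair []` is `encList`. [folklore] -/
theorem foldr_boolPair_eq_encList {α : Type*} (e : α → List Bool) (l : List α) :
    l.foldr (fun a acc => boolPair (e a) acc) [] = encList (l.map e) := by
  induction l with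
  | nil => rfl
  | cons a l ih => simp [ih, encList_cons]

/-- **The shape of the code of an instance**: `⟨bin n, ⟨1^{n²}, encList (entry codes, row-major)⟩⟩`.
[cite: MicciancioGoldwasser2002, Ch. 1 §1.2 (size of a lattice instance)] -/
theorem encode_eq_record (I : LatticeInstance) :
    I.encode = boolPair (encodeNat I.n) (boolPair (unaryEncodeNat (I.n * I.n))
      (encList ((List.ofFn (flatEntries I.basis)).map encodingIntBool.encode))) := by
  rw [I.encode_eq, ← boolPair_encodeNat]
  congr 1
  change encodingIntBool.listBool.encode (List.ofFn (flatEntries I.basis)) = _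
  simp only [Encoding.listBool, List.length_ofFn, foldr_boolPair_eq_encList]

/-- The same shape for any matrix: the code of `⟨n, b⟩`. [folklore] -/
theorem encode_mk_eq_record (b : Fin n → (Fin n → ℤ)) :
    LatticeInstance.encode ⟨n, b⟩ = boolPair (encodeNat n) (boolPair (unaryEncodeNat (n * n))
      (encList ((List.ofFn (flatEntries b)).map encodingIntBool.encode))) :=
  encode_eq_record ⟨n, b⟩

/-- The row-major flat list is the concatenation of the rows. [folklore] -/
theorem ofFn_flatEntries {α : Type*} (b : Fin n → (Fin n → ℤ)) (g : ℤ → α) :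
    List.ofFn (fun m => g (flatEntries b m)) = (List.ofFn fun i : Fin n => List.ofFn fun j : Fin n => g (b i j)).flatten := by
  rw [List.ofFn_mul]
  congr 1
  refine congrArg List.ofFn (funext fun i => congrArg List.ofFn (funext fun j => congrArg g ?_))
  have hn : 0 < n := lt_of_le_of_lt (Nat.zero_le _) j.isLt
  unfold flatEntries
  simp only [finProdFinEquiv_symm_apply, Fin.divNat, Fin.modNat]
  congr 1
  · apply Fin.ext
    simp only
    rw [Nat.mul_comm, Nat.mul_add_div hn, Nat.div_eq_of_lt j.isLt, Nat.add_zero]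
  · apply Fin.ext
    simp only
    rw [Nat.mul_comm, Nat.mul_add_mod, Nat.mod_eq_of_lt j.isLt]

/-- A square table of lists has `n²` items. [folklore] -/
theorem length_flatten_ofFn {α : Type*} (g : Fin n → Fin n → α) :
    (List.ofFn fun i : Fin n => List.ofFn fun j : Fin n => g i j).flatten.length = n * n := by
  rw [List.length_flatten, List.map_ofFn, List.sum_ofFn]
  simp

/-- The entry code is the sign–magnitude pair. [folklore] -/
theorem encodingIntBool_encode_eq (z : ℤ) : encodingIntBool.encode z = boolPair [decide (z < 0)] (encodeNat z.natAbs) := rfl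

/-- The size side conditions of the machine hold on genuine inputs: `n + 1 ≤ lllBudget L` and `n² ≤ lllBudget L`.
[folklore] -/
theorem budget_ge (I : LatticeInstance) : I.n + 1 ≤ lllBudget I.encode.length ∧ I.n * I.n ≤ lllBudget I.encode.length := by
  have h := I.n_le_length_encode
  have hp : I.encode.length + 1 ≤ (I.encode.length + 1) ^ 3 := Nat.le_self_pow (by norm_num) _
  have h64 : (I.encode.length + 1) ^ 3 ≤ lllBudget I.encode.length := by unfold lllBudget; omega
  refine ⟨by omega, ?_⟩
  calc I.n * I.n ≤ (I.encode.length + 1) * (I.encode.length + 1) := Nat.mul_le_mul (by omega) (by omega)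
    _ ≤ (I.encode.length + 1) ^ 3 := by rw [pow_succ, pow_two]; exact Nat.le_mul_of_pos_right _ (by omega)
    _ ≤ _ := h64

/-- The dimension header of the code. [folklore] -/
theorem fstF_encode (I : LatticeInstance) : fstF I.encode = encodeNat I.n := by
  rw [encode_eq_record]; exact fstF_boolPair _ _

/-- The unary length header of the code. [folklore] -/
theorem fstF_sndF_encode (I : LatticeInstance) : fstF (sndF I.encode) = unaryEncodeNat (I.n * I.n) := by
  rw [encode_eq_record]; simp

/-- The entry list of the code. [folklore] -/
theorem sndF_sndF_encode (I : LatticeInstance) :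
    sndF (sndF I.encode) = encList ((List.ofFn (flatEntries I.basis)).map encodingIntBool.encode) := by
  rw [encode_eq_record]; simp

/-- **`entriesF` on the code of an instance**: the flat list of canonical entry codes. [folklore] -/
theorem entriesF_encode (I : LatticeInstance) :
    entriesF I.encode = encList ((List.ofFn fun i : Fin I.n => List.ofFn fun j : Fin I.n => dpEnc (I.basis i j)).flatten) := by
  have hb := (budget_ge I).2
  rw [← length_yardF I.encode] at hb
  rw [entriesF, Function.comp_apply]
  simp only [fanoutFn_apply, Function.comp_apply, fstF_encode, sndF_sndF_encode, prodFn_boolPair, bitsToNat_encodeNat]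
  rw [mapLF_apply _ _ _ hb, List.take_of_length_le (by simp), List.map_map, ← ofFn_flatEntries I.basis dpEnc, List.map_ofFn]
  refine congrArg encList (congrArg List.ofFn (funext fun m => ?_))
  simp only [Function.comp_apply, zItem, sndPow_succ_boolPair, sndPow_zero, sndF_boolPair, encodingIntBool_encode_eq, ofSMFn_encode]

/-- **`parseF` on the code of an instance**: the yardstick, the dimension, and the matrix code. [folklore] -/
theorem parseF_encode (I : LatticeInstance) :
    parseF I.encode = boolPair (yardF I.encode) (boolPair (encodeNat I.n) (matCode I.basis)) := by
  obtain ⟨h1, _⟩ := budget_ge I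
  rw [← length_yardF I.encode] at h1
  set R : List (List (List Bool)) := List.ofFn fun i : Fin I.n => List.ofFn fun j : Fin I.n => dpEnc (I.basis i j) with hR
  have hRlen : ∀ r ∈ R, r.length = I.n := by intro r hr; rw [hR, List.mem_ofFn] at hr; obtain ⟨i, rfl⟩ := hr; simp
  have hRl : R.length = I.n := by simp [hR]
  have hinit : chunkInit I.encode = boolPair (yardF I.encode) (boolPair (encodeNat I.n) (boolPair (encodeNat I.n)
      (boolPair (encList R.flatten) (encList [])))) := by
    simp only [chunkInit, fanoutFn_apply, fstF_encode, entriesF_encode, ← hR, encList_nil]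
  have hM : (takeRevLF ∘ fanoutFn (nthF 0) (fanoutFn (nthF 2) (sndPow 3)) ∘ loopX chunkBody ∘ chunkInit) I.encode = matCode I.basis := by
    rw [Function.comp_apply, Function.comp_apply, Function.comp_apply, hinit, loopX_apply _ _ _ (by omega),
      loopModel_chunkBody (yardF I.encode) (by omega) I.n R [] hRlen hRl.ge]
    simp only [fanoutFn_apply, nthF_zero_boolPair, nthF_succ_boolPair, sndPow_succ_boolPair, sndPow_zero, sndF_boolPair, List.append_nil]
    rw [takeRevLF_apply _ (by omega), List.take_of_length_le (by simp [hRl]), List.reverse_reverse, List.take_of_length_le hRl.le, matCode, hR,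
      List.map_ofFn]
    refine congrArg encList (congrArg List.ofFn (funext fun i => ?_))
    simp only [Function.comp_apply, rowCode, zlist_eq, List.map_ofFn]
    rfl
  rw [parseF, fanoutFn_apply, fanoutFn_apply, fstF_encode, hM]

/-! ### The output -/

/-- The body of the flattening loop on `⟨x, ⟨cnt, ⟨nn, ⟨rows, acc⟩⟩⟩⟩`: pour the first row, reversed, onto `acc`.
[folklore] -/
def flatBody : List Bool → List Bool :=
  fanoutFn (nthF 2) (fanoutFn (sndF ∘ nthF 3) (revOntoLF ∘ fanoutFn (nthF 0) (fanoutFn (nthF 2) (fanoutFn (fstF ∘ nthF 3) (sndPow 3)))))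

/-- `flatBody ∈ FP`. [folklore] -/
theorem flatBody_mem_FP : flatBody ∈ FP :=
  fanoutFn_mem_FP (nthF_mem_FP 2) (fanoutFn_mem_FP (comp_mem_FP sndF_mem_FP (nthF_mem_FP 3)) (comp_mem_FP revOntoLF_mem_FP
    (fanoutFn_mem_FP (nthF_mem_FP 0) (fanoutFn_mem_FP (nthF_mem_FP 2) (fanoutFn_mem_FP (comp_mem_FP fstF_mem_FP (nthF_mem_FP 3)) (sndPow_mem_FP 3))))))

/-- Growth of the flattening body: `≤ |state| + 2|x| + 4`. [folklore] -/
theorem length_flatBody_le (z : List Bool) : (flatBody z).length ≤ (sndPow 1 z).length + (2 * X + 4 : Polynomial ℕ).eval (fstF z).length := by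
  have c1 := length_nthF_succ_add_sndPow_succ_le 1 z
  have c2 := length_nthF_succ_add_sndPow_succ_le 2 z
  have c3 := length_fstF_sndF_le (nthF 3 z)
  have h := length_revOntoLF_le (boolPair (nthF 0 z) (boolPair (nthF 2 z) (boolPair (fstF (nthF 3 z)) (sndPow 3 z))))
  simp only [fstF_boolPair, nthF_succ_boolPair, nthF_zero_boolPair, sndPow_succ_boolPair, sndPow_zero, sndF_boolPair, Nat.reduceAdd] at h c1 c2
  simp only [flatBody, fanoutFn_apply, length_boolPair, Function.comp_apply, eval_add, eval_mul, eval_ofNat, eval_X]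
  have : nthF 0 z = fstF z := rfl
  simp only [this] at h ⊢
  omega

/-- **One round of flattening.** [folklore] -/
theorem flatBody_apply (x c : List Bool) (hx : n ≤ x.length) (S : List (List Bool)) (hS : S.length = n) (RS : List (List Bool)) (A : List (List Bool)) :
    flatBody (boolPair x (boolPair c (boolPair (encodeNat n) (boolPair (encList (encList S :: RS)) (encList A))))) =
      boolPair (encodeNat n) (boolPair (encList RS) (encList (S.reverse ++ A))) := by
  simp only [flatBody, fanoutFn_apply, nthF_succ_boolPair, nthF_zero_boolPair, Function.comp_apply, sndPow_succ_boolPair, sndPow_zero,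
    sndF_boolPair, encList_cons, fstF_boolPair]
  rw [revOntoLF_apply x hx, List.take_of_length_le hS.le]

/-- The flattening loop. [folklore] -/
theorem loopModel_flatBody (x : List Bool) (hx : n ≤ x.length) :
    ∀ (t : ℕ) (R : List (List (List Bool))) (A : List (List Bool)), (∀ r ∈ R, r.length = n) → t ≤ R.length →
      loopModel flatBody x t (boolPair (encodeNat n) (boolPair (encList (R.map encList)) (encList A))) =
        boolPair (encodeNat n) (boolPair (encList ((R.drop t).map encList)) (encList ((R.take t).flatten.reverse ++ A)))
  | 0, R, A, _, _ => by simp [loopModel]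
  | t + 1, [], A, _, h => by simp at h
  | t + 1, r :: R, A, hR, h => by
    rw [loopModel, List.map_cons, flatBody_apply x _ hx r (hR r (by simp)) _ A,
      loopModel_flatBody x hx t R _ (fun r' hr' => hR r' (by simp [hr'])) (by simpa using h)]
    simp

/-- The flat list of the rows of `M` on `w = ⟨inp, M⟩`: the flattening loop from `⟨x, ⟨nn, ⟨nn, ⟨M, ε⟩⟩⟩⟩`, then the
reversal of `n²` items. [folklore] -/
def flatF : List Bool → List Bool :=
  takeRevLF ∘ fanoutFn (nthF 0) (fanoutFn (prodFn ∘ fanoutFn (nthF 2) (nthF 2)) (sndPow 3)) ∘ loopX flatBody ∘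
    fanoutFn (yardF ∘ fstF) (fanoutFn (fstF ∘ fstF) (fanoutFn (fstF ∘ fstF) (fanoutFn sndF (fun _ => []))))

/-- `flatF ∈ FP`. [folklore] -/
theorem flatF_mem_FP : flatF ∈ FP :=
  comp_mem_FP takeRevLF_mem_FP (comp_mem_FP (fanoutFn_mem_FP (nthF_mem_FP 0) (fanoutFn_mem_FP (comp_mem_FP prodFn_mem_FP (fanoutFn_mem_FP (nthF_mem_FP 2) (nthF_mem_FP 2))) (sndPow_mem_FP 3)))
    (comp_mem_FP (loopX_mem_FP flatBody_mem_FP length_flatBody_le)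
      (fanoutFn_mem_FP (comp_mem_FP yardF_mem_FP fstF_mem_FP) (fanoutFn_mem_FP (comp_mem_FP fstF_mem_FP fstF_mem_FP)
        (fanoutFn_mem_FP (comp_mem_FP fstF_mem_FP fstF_mem_FP) (fanoutFn_mem_FP sndF_mem_FP (const_mem_FP _)))))))

/-- **`flatF` on `⟨encode I, matCode b⟩`**: the flat `zlist` of the entries of `b`, row-major. [folklore] -/
theorem flatF_apply (I : LatticeInstance) (b : Fin I.n → (Fin I.n → ℤ)) :
    flatF (boolPair I.encode (matCode b)) = encList ((List.ofFn fun i : Fin I.n => List.ofFn fun j : Fin I.n => dpEnc (b i j)).flatten) := by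
  obtain ⟨h1, h2⟩ := budget_ge I
  rw [← length_yardF I.encode] at h1 h2
  set R : List (List (List Bool)) := List.ofFn fun i : Fin I.n => List.ofFn fun j : Fin I.n => dpEnc (b i j) with hR
  have hRlen : ∀ r ∈ R, r.length = I.n := by intro r hr; rw [hR, List.mem_ofFn] at hr; obtain ⟨i, rfl⟩ := hr; simp
  have hRl : R.length = I.n := by simp [hR]
  have hflat : R.flatten.length = I.n * I.n := by rw [hR]; exact length_flatten_ofFn _
  have hmat : matCode b = encList (R.map encList) := by
    rw [matCode, hR, List.map_ofFn]
    refine congrArg encList (congrArg List.ofFn (funext fun i => ?_))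
    simp [rowCode, zlist_eq, List.map_ofFn, Function.comp_def]
  have hinit : fanoutFn (yardF ∘ fstF) (fanoutFn (fstF ∘ fstF) (fanoutFn (fstF ∘ fstF) (fanoutFn sndF fun _ => []))) (boolPair I.encode (matCode b)) =
      boolPair (yardF I.encode) (boolPair (encodeNat I.n) (boolPair (encodeNat I.n) (boolPair (encList (R.map encList)) (encList [])))) := by
    simp only [fanoutFn_apply, Function.comp_apply, fstF_boolPair, sndF_boolPair, hmat, encList_nil, fstF_encode]
  rw [flatF, Function.comp_apply, Function.comp_apply, Function.comp_apply, hinit, loopX_apply _ _ _ (by omega),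
    loopModel_flatBody (yardF I.encode) (by omega) I.n R [] hRlen hRl.ge]
  simp only [fanoutFn_apply, Function.comp_apply, nthF_zero_boolPair, nthF_succ_boolPair, sndPow_succ_boolPair, sndPow_zero, sndF_boolPair,
    prodFn_boolPair, bitsToNat_encodeNat, List.append_nil]
  rw [List.take_of_length_le hRl.le, takeRevLF_apply _ (by omega), List.take_of_length_le (by rw [List.length_reverse, hflat]),
    List.reverse_reverse]

/-- The entry recoder to sign–magnitude on the item record `⟨x, ⟨p, e⟩⟩`. [folklore] -/
def smItem : List Bool → List Bool := signMagOfZF ∘ sndPow 1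

/-- `smItem ∈ FP`. [folklore] -/
theorem smItem_mem_FP : smItem ∈ FP := comp_mem_FP signMagOfZF_mem_FP (sndPow_mem_FP 1)

/-- `|smItem ⟨x, ⟨p, e⟩⟩| ≤ |e| + 5`. [folklore] -/
theorem length_smItem_le (x p e : List Bool) : (smItem (boolPair x (boolPair p e))).length ≤ 1 * e.length + (5 : Polynomial ℕ).eval x.length := by
  have h1 := length_signMagOfZF_le e
  have h2 := zlen_le_length e
  simp only [smItem, Function.comp_apply, sndPow_succ_boolPair, sndPow_zero, sndF_boolPair, one_mul, eval_ofNat]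
  omega

/-- **The output** on `w = ⟨inp, M⟩`: headers copied from `inp`, entries of `M` recoded to sign–magnitude in row-major
order. [cite: MicciancioGoldwasser2002, Ch. 1 §1.2 (size of a lattice instance)] -/
def outF : List Bool → List Bool :=
  fanoutFn (fstF ∘ fstF) (fanoutFn (fstF ∘ sndF ∘ fstF)
    (mapLF smItem ∘ fanoutFn (yardF ∘ fstF) (fanoutFn (prodFn ∘ fanoutFn (fstF ∘ fstF) (fstF ∘ fstF)) (fanoutFn (fun _ => []) flatF))))

/-- `outF ∈ FP`. [folklore] -/
theorem outF_mem_FP : outF ∈ FP :=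
  fanoutFn_mem_FP (comp_mem_FP fstF_mem_FP fstF_mem_FP) (fanoutFn_mem_FP (comp_mem_FP fstF_mem_FP (comp_mem_FP sndF_mem_FP fstF_mem_FP))
    (comp_mem_FP (mapLF_mem_FP smItem_mem_FP (w := 1) (by norm_num) length_smItem_le)
      (fanoutFn_mem_FP (comp_mem_FP yardF_mem_FP fstF_mem_FP) (fanoutFn_mem_FP (comp_mem_FP prodFn_mem_FP (fanoutFn_mem_FP (comp_mem_FP fstF_mem_FP fstF_mem_FP) (comp_mem_FP fstF_mem_FP fstF_mem_FP)))
        (fanoutFn_mem_FP (const_mem_FP _) flatF_mem_FP)))))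

/-- **`outF ⟨encode I, matCode b⟩ = encode ⟨I.n, b⟩.`** [folklore] -/
theorem outF_apply (I : LatticeInstance) (b : Fin I.n → (Fin I.n → ℤ)) :
    outF (boolPair I.encode (matCode b)) = LatticeInstance.encode ⟨I.n, b⟩ := by
  obtain ⟨_, h2⟩ := budget_ge I
  rw [← length_yardF I.encode] at h2
  have hE : mapLF smItem (boolPair (yardF I.encode) (boolPair (encodeNat (I.n * I.n)) (boolPair []
      (encList ((List.ofFn fun i : Fin I.n => List.ofFn fun j : Fin I.n => dpEnc (b i j)).flatten))))) =
      encList ((List.ofFn (flatEntries b)).map encodingIntBool.encode) := by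
    rw [mapLF_apply _ _ _ h2, List.take_of_length_le (le_of_eq (length_flatten_ofFn _)), ← ofFn_flatEntries b dpEnc,
      List.map_ofFn, List.map_ofFn]
    refine congrArg encList (congrArg List.ofFn (funext fun m => ?_))
    simp only [Function.comp_apply, smItem, sndPow_succ_boolPair, sndPow_zero, sndF_boolPair, signMagOfZF_dpEnc, encodingIntBool_encode_eq]
  rw [outF, fanoutFn_apply, fanoutFn_apply, encode_mk_eq_record b]
  simp only [Function.comp_apply, fstF_boolPair, fanoutFn_apply, flatF_apply I b, fstF_encode, fstF_sndF_encode,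
    prodFn_boolPair, bitsToNat_encodeNat, hE]

/-! ### The machine and the discharge of `lllReduce_polyTime` -/

/-- **The LLL machine** as a total string function: parse, run `lllBudget L` saturated passes, re-encode.
[cite: LenstraLenstraLovasz1982, Prop. 1.26] -/
def lllMachineF : List Bool → List Bool := outF ∘ fanoutFn id (lllCoreF ∘ parseF)

/-- **`lllMachineF ∈ FP`** (polynomial time, by composition of bricks). [cite: AroraBarak2009, §1.3 (polynomial time is closed under composition)] -/
theorem lllMachineF_mem_FP : lllMachineF ∈ FP :=
  comp_mem_FP outF_mem_FP (fanoutFn_mem_FP OracleCompose.id_mem_FP (comp_mem_FP lllCoreF_mem_FP parseF_mem_FP))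

/-- **The machine simulates the saturated run**: on the code of any instance it returns the code of
`⟨n, ((capStep W)^[W] (lllStart B)).b⟩`, `W = lllBudget |encode I|`. [cite: LenstraLenstraLovasz1982, Prop. 1.26] -/
theorem lllMachineF_encode (I : LatticeInstance) :
    lllMachineF I.encode = LatticeInstance.encode
      ⟨I.n, ((capStep (lllBudget I.encode.length))^[lllBudget I.encode.length] (lllStart I.basis)).b⟩ := by
  obtain ⟨h1, _⟩ := budget_ge I
  rw [lllMachineF, Function.comp_apply, fanoutFn_apply, id, Function.comp_apply, parseF_encode,
    lllCoreF_apply _ _ (by rw [length_yardF]; exact h1), length_yardF, outF_apply]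

end LLLMachine

open LLLMachine in
/-- **Discharge of `lllReduce_polyTime` (LLL82 Prop. 1.26, polynomial running time of LLL).** The function
`I ↦ ⟨n, (capStep W)^{W} (lllStart B)⟩` (`W = 64 (|encode I| + 1)³`) is polynomial-time computable for the
lattice-instance encoding — it is induced by the `FP` string function `lllMachineF` — and agrees with
`LatticeInstance.lllReduce` (LLL82's algorithm with `δ = 3/4`) on every nonsingular instance
(`LatticeInstance.lllReduce_eq_capRun`). [cite: LenstraLenstraLovasz1982, Prop. 1.26] -/
theorem lllReduce_polyTime_holds : lllReduce_polyTime := by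
  refine ⟨fun I => ⟨I.n, ((capStep (lllBudget I.encode.length))^[lllBudget I.encode.length] (lllStart I.basis)).b⟩, ?_,
    fun I hI => (I.lllReduce_eq_capRun hI).symm⟩
  exact PolyTimeComputable.of_encode_eq (ea := (id : List Bool → List Bool)) (eb := (id : List Bool → List Bool)) (f := lllMachineF)
    LatticeInstance.encode (fun _ => rfl) (fun I => lllMachineF_encode I) lllMachineF_mem_FP

end Literature.Algebra.EuclideanLattices
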